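/-
Copyright: lit-balaban cell (HOME `run/shared/lean/pub/lit-balaban/`), Phase-2 proof seat p12 (gen 12).  The proofs reproduce the
printed arguments; nothing is claimed beyond what the kernel checks below.
-/
import Literature.MathematicalPhysics.QuantumFieldTheory.DybalskiStottmeisterTanimoto2024.DST24InftyBounds

/-!
# `DybalskiStottmeisterTanimoto2024.DST24InteriorCriticalPoint` — [DybalskiStottmeisterTanimoto2024] **Theorem 1 in the printed
# quantifier form «for `ε₁ ≤ ε²`, sufficiently small (uniformly in `n`)»** (Propositions (preserving-space), (contraction)) and
# **Remark 1.1 (3)**: «By setting `ε₁ < ε²` one can ensure that the critical point is not at the boundary of `Conf_ε(Ω)`» — PROVED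

statement-level skeleton of published theorems with citation tags; proofs where landed; nothing here is a claim about
the Yang–Mills mass gap

W. Dybalski, A. Stottmeister, Y. Tanimoto, *The Bałaban variational problem in the non-linear sigma model*, Rev. Math. Phys.
**36** (2024), arXiv:2403.09800; source held `paper:arxiv-2403.09800` (§1.1 Theorem 1 and Remark 1.1 = tex chunk p0006 L51–L63;
§4.1 Propositions (preserving-space)/(contraction) = p0011 L62, L88; §4.7 = p0018 L91–L101).  Unit `lit-balaban-p12` (gen 12).
Imports only `DST24InftyBounds` (p12 gen 10: Lemma (infty-bounds) PROVED, `Theorem1_holds`), hence the whole main line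
`DST24MainTheorem` (p12 gen 7: `existsUnique_critical`, `eps_choice`, `QGRQ_lemma`).

WHAT IS PRINTED.
* Theorem 1 (§1.1, p0006 L51): «Let `G₀ = SU(2)`. Then there exist `0 < ε, ε₁ ≤ 1` s.t. for `V ∈ Conf_{ε₁}(Ω₁)` the action `𝒜` has
  a unique critical point over `Conf_ε(Ω)` with the constraint `𝒞(U) = V`. The parameters `ε, ε₁` are independent of `n` but may
  depend on `L`.» — typed `DST24Setting.Theorem1 L`, PROVED `DST24InftyBounds.Theorem1_holds` (ONE pair `(ε, ε₁ = ε²)`).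
* Proposition (preserving-space) (§4.1, p0011 L62): «For `ε₁ ≤ ε²`, sufficiently small (uniformly in `n`), `𝕋` maps `X_ε` into
  itself.»; Proposition (contraction) (p0011 L88): «Under the assumptions of Proposition (preserving-space) and for `ε, ε₁`,
  sufficiently small (uniformly in `n`), the map `𝕋 : X_ε → X_ε` is a contraction.» — i.e. the fixed point, hence the critical
  point, exists and is unique for EVERY sufficiently small `ε` and EVERY `ε₁ ≤ ε²`, not only for one pair.
* Remark 1.1 (3) (§1.1, p0006 L61–L63): «By setting `ε₁ < ε²` one can ensure that the critical point is not at the boundary of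
  `Conf_ε(Ω)`.  Indeed, a critical point in `Conf_ε(Ω)` is also a critical point for `Conf_{ε′}(Ω)` s.t. `ε₁ < (ε′)² < ε²`.  Thus
  the unique critical point must belong to the interior of `Conf_ε(Ω)`.»

WHAT IS PROVED HERE (Mathlib + the DST24 files; no `def … : Prop`, no hypotheses beyond the print's `1 < L`).
* §1 `smallness_uniform` — the arithmetic of «sufficiently small (uniformly in `n`)»: the seven side conditions of
  `DST24MainTheorem.existsUnique_critical` (domain `4c_{1/2}Lε ≤ ½`, `≤ κ₀`; (preserving-space) amplitude and `d₀` conditions;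
  (contraction) rate `q ≤ ½`) hold for ALL `0 < ε ≤ ε₀` and ALL `0 ≤ ε₁ ≤ ε²`, with one explicit `ε₀ = ε₀(κ₁, κ₀, K₁, K₂, K₃) > 0`
  (the same minimum as gen 7's `eps_choice`, which produced a single `ε`).
* §2 **Theorem 1, uniform form** — `theorem1_uniform_of_Linfty_bounds` (from the two `𝓛^∞` inputs, as `theorem1_of_Linfty_bounds`),
  `theorem1_uniform_of_infty_bounds` (from Lemma (infty-bounds) via Lemma (Q-G-R-Q-lemma)), and unconditionally
  **`theorem1_uniform (hL1 : 1 < L)`**: `∃ ε₀ ∈ (0, 1]` (depending on `L` only) such that for every `0 < ε ≤ ε₀`, every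
  `0 ≤ ε₁ ≤ ε²`, every volume `n₁` and every `V ∈ Conf_{ε₁}(Ω₁)` there is a UNIQUE `U ∈ Conf_ε(Ω)` with `𝒞(U) = V` which is a
  constrained critical point of `𝒜` (`Theorem1 L` = `DST24InftyBounds.Theorem1_holds` is the instance `ε = ε₀`, `ε₁ = ε₀²`).  The print's
  standing assumption «`L` odd» is not used by the proof and is therefore not a hypothesis here.
* §3 **Remark 1.1 (3)** — `smallField_mono` (`Conf_{ε′}(Ω) ⊆ Conf_ε(Ω)` for `ε′ ≤ ε`); `mem_smallField_of_existsUnique` («a critical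
  point in `Conf_ε(Ω)` is also a critical point for `Conf_{ε′}(Ω)`»: uniqueness over `Conf_ε` + existence over `Conf_{ε′} ⊆ Conf_ε`);
  **`remark11`**: for `0 < ε ≤ ε₀`, `0 ≤ ε₁ < ε²`, `V ∈ Conf_{ε₁}(Ω₁)`, the unique constrained critical point `U ∈ Conf_ε(Ω)` lies in
  `Conf_{ε′}(Ω)` for an `ε′` with `ε₁ ≤ ε′² ` and `ε′ < ε` (namely `ε′ = max(√ε₁, ε/2)`), hence **`remark11_strict`**: every bond
  variable satisfies the STRICT small-field inequality `‖∂U(b) − 1‖ < ε` («not at the boundary»); and the topological reading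
  **`remark11_interior`**: `U ∈ interior (Conf_ε(Ω))` for the product topology of `Conf(Ω) = (Ω → SU(2))`, `SU(2)` carrying the
  tree's great-circle metric (`Federbush1986.PureAveragesSU2`) — via `SU2.norm_val_sub_val_le_dist` (chord ≤ arc,
  `1 − θ²/2 ≤ cos θ`), `SU2.continuous_val`, `continuous_pd_val`, `isOpen_strictSmallField`, `strictSmallField_subset_interior`.

DEVIATIONS (stated, as the house rule asks).  (a) «interior» is taken in `Conf(Ω) = Ω → SU(2)` with the product topology of the
tree's metric on `SU(2)` (great-circle distance; it induces the standard topology, `SU2.continuous_val`); the print does not name a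
topology — both the strict-inequality form and the topological form are given.  (b) `ε₀` depends on `L` through the constants
`C_Γ(L)`, `C_Q(L)` of Lemma (infty-bounds) (print: «may depend on `L`»).  Nothing here refers to or asserts anything about
Bałaban's papers. [cite: DybalskiStottmeisterTanimoto2024, §1.1 Theorem 1, Remark 1.1 (3); §4.1 Propositions (preserving-space), (contraction); §4.7]
-/

namespace Literature.MathematicalPhysics.QuantumFieldTheory.DybalskiStottmeisterTanimoto2024.DST24InteriorCriticalPoint

open scoped Quaternion RealInnerProductSpace BigOperators NNReal Topology
open Literature.MathematicalPhysics.QuantumFieldTheory.Federbush1986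
open Literature.MathematicalPhysics.QuantumFieldTheory.DybalskiStottmeisterTanimoto2024.DST24Setting
open Literature.MathematicalPhysics.QuantumFieldTheory.DybalskiStottmeisterTanimoto2024.DST24Configurations
open Literature.MathematicalPhysics.QuantumFieldTheory.DybalskiStottmeisterTanimoto2024.DST24LinearConstraint
open Literature.MathematicalPhysics.QuantumFieldTheory.DybalskiStottmeisterTanimoto2024.DST24CriticalPoint
open Literature.MathematicalPhysics.QuantumFieldTheory.DybalskiStottmeisterTanimoto2024.DST24GreenFunction
open Literature.MathematicalPhysics.QuantumFieldTheory.DybalskiStottmeisterTanimoto2024.DST24CriticalPointEquation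
open Literature.MathematicalPhysics.QuantumFieldTheory.DybalskiStottmeisterTanimoto2024.DST24MainTheorem
open Literature.MathematicalPhysics.QuantumFieldTheory.DybalskiStottmeisterTanimoto2024.DST24InftyBounds

noncomputable section

variable {L n₁ : ℕ}

/-! ## §1 «for `ε₁ ≤ ε²`, sufficiently small (uniformly in `n`)»: the side conditions hold for ALL small `ε` and ALL `ε₁ ≤ ε²` -/
set_option maxHeartbeats 400000 in
/-- The arithmetic of «sufficiently small (uniformly in `n`)» in its printed quantifier form: given `κ₁ = 4c_{1/2}L ≥ 8`, the domain
radius `κ₀ > 0` of Lemma (Q-G-R-Q-lemma) and non-negative constants `K₁, K₂, K₃` (built from `C_Γ, C_D`), there is ONE `ε₀ > 0` such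
that every `0 < ε ≤ ε₀` together with every `0 ≤ ε₁ ≤ ε²` satisfies all side conditions of Propositions (preserving-space) and
(contraction) (cf. `DST24MainTheorem.eps_choice`, which exhibits a single such `ε` with `ε₁ = ε²`).
[cite: DybalskiStottmeisterTanimoto2024, §4.1 Proposition (preserving-space) («For `ε₁ ≤ ε²`, sufficiently small (uniformly in `n`)»), Proposition (contraction)] -/
theorem smallness_uniform {κ₁ κ₀ K₁ K₂ K₃ : ℝ} (hκ₁ : 8 ≤ κ₁) (hκ₀ : 0 < κ₀) (hK₁ : 0 ≤ K₁) (hK₂ : 0 ≤ K₂) (hK₃ : 0 ≤ K₃) :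
    ∃ ε₀ : ℝ, 0 < ε₀ ∧ ε₀ ≤ 1 / 16 ∧ ∀ ε : ℝ, 0 < ε → ε ≤ ε₀ → ∀ ε₁ : ℝ, 0 ≤ ε₁ → ε₁ ≤ ε ^ 2 →
      κ₁ * ε ≤ 1 / 2 ∧ κ₁ * ε ≤ κ₀ ∧ K₁ * ((κ₁ * ε) ^ 2 + ε₁) ≤ κ₁ * ε ∧
        ε₁ + 4 * (K₁ * ((κ₁ * ε) ^ 2 + ε₁)) ≤ ε ∧ K₂ * (κ₁ * ε + ε₁) + K₃ * ((κ₁ * ε) ^ 2 + ε₁) ≤ 1 / 2 := by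
  have hκ₁0 : 0 < κ₁ := by linarith
  set S := K₂ * (κ₁ + 1) + K₃ * (κ₁ ^ 2 + 1) with hS
  have hS0 : 0 ≤ S := by positivity
  set ε₀ := min (1 / (2 * κ₁)) (min (κ₀ / κ₁) (min (κ₁ / (K₁ * (κ₁ ^ 2 + 1) + 1))
    (min (1 / (1 + 4 * K₁ * (κ₁ ^ 2 + 1))) (1 / (2 * S + 1))))) with hε₀
  have hε₀0 : 0 < ε₀ := by positivity
  have g1 : ε₀ ≤ 1 / (2 * κ₁) := min_le_left _ _
  have g2 : ε₀ ≤ κ₀ / κ₁ := (min_le_right _ _).trans (min_le_left _ _)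
  have g3 : ε₀ ≤ κ₁ / (K₁ * (κ₁ ^ 2 + 1) + 1) := ((min_le_right _ _).trans (min_le_right _ _)).trans (min_le_left _ _)
  have g4 : ε₀ ≤ 1 / (1 + 4 * K₁ * (κ₁ ^ 2 + 1)) :=
    (((min_le_right _ _).trans (min_le_right _ _)).trans (min_le_right _ _)).trans (min_le_left _ _)
  have g5 : ε₀ ≤ 1 / (2 * S + 1) :=
    (((min_le_right _ _).trans (min_le_right _ _)).trans (min_le_right _ _)).trans (min_le_right _ _)
  have hε₀16 : ε₀ ≤ 1 / 16 := g1.trans (one_div_le_one_div_of_le (by norm_num) (by linarith))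
  refine ⟨ε₀, hε₀0, hε₀16, fun ε hε0 hεε₀ ε₁ hε₁0 hε₁ => ?_⟩
  have h1 : ε ≤ 1 / (2 * κ₁) := hεε₀.trans g1
  have h2 : ε ≤ κ₀ / κ₁ := hεε₀.trans g2
  have h3 : ε ≤ κ₁ / (K₁ * (κ₁ ^ 2 + 1) + 1) := hεε₀.trans g3
  have h4 : ε ≤ 1 / (1 + 4 * K₁ * (κ₁ ^ 2 + 1)) := hεε₀.trans g4
  have h5 : ε ≤ 1 / (2 * S + 1) := hεε₀.trans g5
  have hε1 : ε ≤ 1 := by linarith [hεε₀.trans hε₀16]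
  have hεsq : ε ^ 2 ≤ ε := by nlinarith
  have hε₁ε : ε₁ ≤ ε := hε₁.trans hεsq
  have hsq : (κ₁ * ε) ^ 2 + ε₁ ≤ (κ₁ ^ 2 + 1) * ε ^ 2 := by nlinarith
  have hsq0 : 0 ≤ (κ₁ * ε) ^ 2 + ε₁ := by positivity
  refine ⟨?_, ?_, ?_, ?_, ?_⟩
  · calc κ₁ * ε ≤ κ₁ * (1 / (2 * κ₁)) := mul_le_mul_of_nonneg_left h1 hκ₁0.le
      _ = 1 / 2 := by field_simp
  · rw [mul_comm]; exact (le_div_iff₀ hκ₁0).mp h2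
  · have h3' : ε * (K₁ * (κ₁ ^ 2 + 1) + 1) ≤ κ₁ := (le_div_iff₀ (by positivity)).mp h3
    have hA : K₁ * ((κ₁ * ε) ^ 2 + ε₁) ≤ K₁ * (κ₁ ^ 2 + 1) * ε ^ 2 := by
      have := mul_le_mul_of_nonneg_left hsq hK₁; linarith [this]
    have hB : K₁ * (κ₁ ^ 2 + 1) * ε ^ 2 ≤ κ₁ * ε := by
      have := mul_le_mul_of_nonneg_right h3' hε0.le
      nlinarith
    exact hA.trans hB
  · have h4' : ε * (1 + 4 * K₁ * (κ₁ ^ 2 + 1)) ≤ 1 := (le_div_iff₀ (by positivity)).mp h4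
    have hA : ε₁ + 4 * (K₁ * ((κ₁ * ε) ^ 2 + ε₁)) ≤ (1 + 4 * K₁ * (κ₁ ^ 2 + 1)) * ε ^ 2 := by
      have := mul_le_mul_of_nonneg_left hsq hK₁; nlinarith [this]
    have hB : (1 + 4 * K₁ * (κ₁ ^ 2 + 1)) * ε ^ 2 ≤ ε := by
      have := mul_le_mul_of_nonneg_right h4' hε0.le
      nlinarith
    exact hA.trans hB
  · have h5' : ε * (2 * S + 1) ≤ 1 := (le_div_iff₀ (by positivity)).mp h5
    have hSε : S * ε ≤ 1 / 2 := by nlinarith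
    have hb1 : K₂ * (κ₁ * ε + ε₁) ≤ K₂ * (κ₁ + 1) * ε := by nlinarith [mul_le_mul_of_nonneg_left hε₁ε hK₂]
    have hb2 : K₃ * ((κ₁ * ε) ^ 2 + ε₁) ≤ K₃ * (κ₁ ^ 2 + 1) * ε := by
      have h' : (κ₁ * ε) ^ 2 ≤ κ₁ ^ 2 * ε := by nlinarith [mul_le_mul_of_nonneg_left hεsq (sq_nonneg κ₁)]
      nlinarith [mul_le_mul_of_nonneg_left hε₁ε hK₃, mul_le_mul_of_nonneg_left h' hK₃]
    calc K₂ * (κ₁ * ε + ε₁) + K₃ * ((κ₁ * ε) ^ 2 + ε₁) ≤ K₂ * (κ₁ + 1) * ε + K₃ * (κ₁ ^ 2 + 1) * ε := add_le_add hb1 hb2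
      _ = S * ε := by rw [hS]; ring
      _ ≤ 1 / 2 := hSε

/-! ## §2 Theorem 1 in the uniform form: every `0 < ε ≤ ε₀`, every `0 ≤ ε₁ ≤ ε²` -/

/-- **Theorem 1, uniform form, from the `𝓛^∞` inputs** (cf. `DST24MainTheorem.theorem1_of_Linfty_bounds`).  Assume, for the fixed
`L > 1`, uniformly in `n₁`: «`‖Γ‖_{∞,∞;Ω} ≤ C_Γ`» (`hΓ`) and the two-sided inverse `D_{A⃗}⁻¹` of `D_{A⃗} = QΓR*_{A⃗}Q*` with
«`‖D_{A⃗}⁻¹‖_{∞,∞;Ω₁} ≤ C_D`» on `Conf⃗^{κ₀}(Ω)` (`hD`, Lemma (Q-G-R-Q-lemma)).  Then there is `ε₀ ∈ (0, 1]` such that for EVERY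
`0 < ε ≤ ε₀` and EVERY `0 ≤ ε₁ ≤ ε²` («for `ε₁ ≤ ε²`, sufficiently small (uniformly in `n`)»), for every `n₁` and every
`V ∈ Conf_{ε₁}(Ω₁)`, there exists a unique constrained critical point of `𝒜` over `Conf_ε(Ω)`.
[cite: DybalskiStottmeisterTanimoto2024, §4.1 Propositions (preserving-space), (contraction), Theorem (main-theorem-intext); §1.1 Theorem 1] -/
theorem theorem1_uniform_of_Linfty_bounds (hL : 0 < L) (hL1 : 1 < L) {CΓ CD κ₀ : ℝ} (hκ₀ : 0 < κ₀)
    (hΓ : ∀ {n₁ : ℕ} (f : Site L n₁ → su2), ‖Gamma hL f‖ ≤ CΓ * ‖f‖)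
    (Dinv : ∀ {n₁ : ℕ}, (Site L n₁ → su2) → ((CSite n₁ → su2) →ₗ[ℝ] (CSite n₁ → su2)))
    (hD : ∀ {n₁ : ℕ} (A : Site L n₁ → su2), (∀ x, ‖A x‖ ≤ κ₀) →
      (∀ c, Dinv A (Dop hL A c) = c) ∧ (∀ g, Dop hL A (Dinv A g) = g) ∧ ∀ g, ‖Dinv A g‖ ≤ CD * ‖g‖) :
    ∃ ε₀ : ℝ, 0 < ε₀ ∧ ε₀ ≤ 1 ∧ ∀ ε : ℝ, 0 < ε → ε ≤ ε₀ → ∀ ε₁ : ℝ, 0 ≤ ε₁ → ε₁ ≤ ε ^ 2 →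
      ∀ {n₁ : ℕ} (V : CConf n₁), V ∈ smallFieldC ε₁ →
        ∃! U : Conf L n₁, U ∈ smallField ε ∧ IsConstrainedCritical V U := by
  -- non-negative versions of the constants
  have hΓ' : ∀ {n₁ : ℕ} (f : Site L n₁ → su2), ‖Gamma hL f‖ ≤ max CΓ 0 * ‖f‖ :=
    fun f => (hΓ f).trans (mul_le_mul_of_nonneg_right (le_max_left _ _) (norm_nonneg _))
  have hD' : ∀ {n₁ : ℕ} (A : Site L n₁ → su2), (∀ x, ‖A x‖ ≤ κ₀) →
      (∀ c, Dinv A (Dop hL A c) = c) ∧ (∀ g, Dop hL A (Dinv A g) = g) ∧ ∀ g, ‖Dinv A g‖ ≤ max CD 0 * ‖g‖ := by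
    intro n₁ A hA
    obtain ⟨h1, h2, h3⟩ := hD A hA
    exact ⟨h1, h2, fun g => (h3 g).trans (mul_le_mul_of_nonneg_right (le_max_left _ _) (norm_nonneg _))⟩
  set CΓ' := max CΓ 0 with hCΓ'
  set CD' := max CD 0 with hCD'
  have hCΓ0 : 0 ≤ CΓ' := le_max_right _ _
  have hCD0 : 0 ≤ CD' := le_max_right _ _
  have hLr : (2 : ℝ) ≤ L := by exact_mod_cast hL1
  have hκ₁ : 8 ≤ 4 * ch * (L : ℝ) := by nlinarith [one_le_ch]
  obtain ⟨ε₀, hε₀0, hε₀16, hall⟩ := smallness_uniform (κ₀ := κ₀) (K₁ := CΓ' * (2 * CΓ' * CD' + 1) * 24)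
    (K₂ := (2 * CΓ' * CD' + 1) * CΓ' * 96) (K₃ := (4 * CΓ' ^ 2 * CD' ^ 2 + 2 * CΓ' * CD') * CΓ' * 24) hκ₁ hκ₀
    (by positivity) (by positivity) (by positivity)
  refine ⟨ε₀, hε₀0, by linarith, fun ε hε0 hεε₀ ε₁ hε₁0 hε₁ n₁ V hV => ?_⟩
  obtain ⟨hκ, hκκ₀, hamp, hd0, hq⟩ := hall ε hε0 hεε₀ ε₁ hε₁0 hε₁
  have hε16 : ε ≤ 1 / 16 := hεε₀.trans hε₀16
  have hεsq : ε ^ 2 ≤ ε := by nlinarith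
  refine existsUnique_critical hL Dinv (κ₀ := κ₀) (CΓ := CΓ') (CD := CD') hε0 ?_ ?_ hε₁0 (by nlinarith)
    (hε₁.trans hεsq) hCΓ0 hCD0 hΓ' hD' ?_ ?_ ?_ hV
  · simpa only [mul_assoc] using hκ
  · simpa only [mul_assoc] using hκκ₀
  · have := hamp; ring_nf at this ⊢; linarith
  · have := hd0; ring_nf at this ⊢; linarith
  · have := hq; ring_nf at this ⊢; linarith

/-- **Theorem 1, uniform form, from Lemma (infty-bounds)** (cf. `DST24MainTheorem.theorem1_of_infty_bounds`): the bounds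
«`‖Γ‖_{∞,∞;Ω} ≤ C`», «`‖(QΓQ*)⁻¹‖_{∞,∞;Ω₁} ≤ C`» uniformly in `n₁` give, through Lemma (Q-G-R-Q-lemma) (`QGRQ_lemma`), the
uniform Theorem 1. [cite: DybalskiStottmeisterTanimoto2024, §4.3 Lemma (infty-bounds); §4.4 Lemma (Q-G-R-Q-lemma); §4.1 Propositions (preserving-space), (contraction)] -/
theorem theorem1_uniform_of_infty_bounds (hL : 0 < L) (hL1 : 1 < L) {CΓ CQ : ℝ}
    (hΓ : ∀ {n₁ : ℕ} (f : Site L n₁ → su2), ‖Gamma hL f‖ ≤ CΓ * ‖f‖)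
    (hQ : ∀ {n₁ : ℕ} (g : CSite n₁ → su2), ‖(QGammaQstar hL).symm g‖ ≤ CQ * ‖g‖) :
    ∃ ε₀ : ℝ, 0 < ε₀ ∧ ε₀ ≤ 1 ∧ ∀ ε : ℝ, 0 < ε → ε ≤ ε₀ → ∀ ε₁ : ℝ, 0 ≤ ε₁ → ε₁ ≤ ε ^ 2 →
      ∀ {n₁ : ℕ} (V : CConf n₁), V ∈ smallFieldC ε₁ →
        ∃! U : Conf L n₁, U ∈ smallField ε ∧ IsConstrainedCritical V U := by
  have hΓ' : ∀ {n₁ : ℕ} (f : Site L n₁ → su2), ‖Gamma hL f‖ ≤ max CΓ 0 * ‖f‖ :=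
    fun f => (hΓ f).trans (mul_le_mul_of_nonneg_right (le_max_left _ _) (norm_nonneg _))
  have hQ' : ∀ {n₁ : ℕ} (g : CSite n₁ → su2), ‖(QGammaQstar hL).symm g‖ ≤ max CQ 0 * ‖g‖ :=
    fun g => (hQ g).trans (mul_le_mul_of_nonneg_right (le_max_left _ _) (norm_nonneg _))
  exact theorem1_uniform_of_Linfty_bounds hL hL1 (CD := 2 * max CQ 0) (κ₀ := 1 / (4 * max CQ 0 * max CΓ 0 + 4))
    (by positivity) hΓ' (fun A => DinvStd hL A)
    (fun A hA => QGRQ_lemma hL (le_max_right _ _) (le_max_right _ _) hΓ' hQ' hA)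

/-- **THEOREM 1 of [DybalskiStottmeisterTanimoto2024], UNIFORM FORM — PROVED.**  For every `L > 1` there is `ε₀ = ε₀(L) ∈ (0, 1]`
such that for EVERY `0 < ε ≤ ε₀`, EVERY `0 ≤ ε₁ ≤ ε²`, every volume `n = L·n₁` and every `V ∈ Conf_{ε₁}(Ω₁)`, the action `𝒜` has
a unique critical point over `Conf_ε(Ω)` with the constraint `𝒞(U) = V` — the quantifier form in which §4.1 proves Theorem 1
(«for `ε₁ ≤ ε²`, sufficiently small (uniformly in `n`)»); Lemma (infty-bounds) enters by `DST24InftyBounds.norm_Gamma_le` /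
`norm_QGammaQstar_symm_le`.  (The print's «`L` odd» is not used.)
[cite: DybalskiStottmeisterTanimoto2024, §1.1 Theorem 1; §4.1 Propositions (preserving-space), (contraction), Theorem (main-theorem-intext); §4.7] -/
theorem theorem1_uniform (hL1 : 1 < L) :
    ∃ ε₀ : ℝ, 0 < ε₀ ∧ ε₀ ≤ 1 ∧ ∀ ε : ℝ, 0 < ε → ε ≤ ε₀ → ∀ ε₁ : ℝ, 0 ≤ ε₁ → ε₁ ≤ ε ^ 2 →
      ∀ {n₁ : ℕ} (V : CConf n₁), V ∈ smallFieldC ε₁ →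
        ∃! U : Conf L n₁, U ∈ smallField ε ∧ IsConstrainedCritical V U :=
  theorem1_uniform_of_infty_bounds (lt_trans zero_lt_one hL1) hL1 (fun f => norm_Gamma_le _ f)
    (fun g => norm_QGammaQstar_symm_le _ g)

/-! ## §3 Remark 1.1 (3): «the critical point is not at the boundary of `Conf_ε(Ω)`» -/

/-- `Conf_{ε′}(Ω) ⊆ Conf_ε(Ω)` for `ε′ ≤ ε`. [cite: DybalskiStottmeisterTanimoto2024, §1.1 (small-field-condition), Remark 1.1 (3)] -/
theorem smallField_mono {ε ε' : ℝ} (h : ε' ≤ ε) : (smallField ε' : Set (Conf L n₁)) ⊆ smallField ε :=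
  fun _U hU b => (hU b).trans h

/-- «Indeed, a critical point in `Conf_ε(Ω)` is also a critical point for `Conf_{ε′}(Ω)`»: if the constrained critical point over
`Conf_ε(Ω)` is unique and one exists over `Conf_{ε′}(Ω) ⊆ Conf_ε(Ω)` (`ε′ ≤ ε`), then every constrained critical point of
`Conf_ε(Ω)` lies in `Conf_{ε′}(Ω)`. [cite: DybalskiStottmeisterTanimoto2024, §1.1 Remark 1.1 (3)] -/
theorem mem_smallField_of_existsUnique {ε ε' : ℝ} (h : ε' ≤ ε) {V : CConf n₁}
    (huniq : ∃! U : Conf L n₁, U ∈ smallField ε ∧ IsConstrainedCritical V U)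
    (hex : ∃ U' : Conf L n₁, U' ∈ smallField ε' ∧ IsConstrainedCritical V U')
    {U : Conf L n₁} (hU : U ∈ smallField ε) (hc : IsConstrainedCritical V U) : U ∈ smallField ε' := by
  obtain ⟨U', hU', hc'⟩ := hex
  have hUU' : U = U' := huniq.unique ⟨hU, hc⟩ ⟨smallField_mono h hU', hc'⟩
  rw [hUU']
  exact hU'

/-- **Remark 1.1 (3).** «By setting `ε₁ < ε²` one can ensure that the critical point is not at the boundary of `Conf_ε(Ω)`.  Indeed,
a critical point in `Conf_ε(Ω)` is also a critical point for `Conf_{ε′}(Ω)` s.t. `ε₁ < (ε′)² < ε²`.»  PROVED in the form: with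
`ε₀(L)` of `theorem1_uniform`, for every `0 < ε ≤ ε₀`, `0 ≤ ε₁ < ε²` and `V ∈ Conf_{ε₁}(Ω₁)`, the constrained critical point over
`Conf_ε(Ω)` exists uniquely AND every constrained critical `U ∈ Conf_ε(Ω)` lies in `Conf_{ε′}(Ω)` for some `ε′ < ε` with
`ε₁ ≤ ε′²` (here `ε′ = max(√ε₁, ε/2)`; Theorem 1 uniform at `(ε′, ε₁)` supplies the critical point of `Conf_{ε′}(Ω)`).
[cite: DybalskiStottmeisterTanimoto2024, §1.1 Remark 1.1 (3)] -/
theorem remark11 (hL1 : 1 < L) :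
    ∃ ε₀ : ℝ, 0 < ε₀ ∧ ε₀ ≤ 1 ∧ ∀ ε : ℝ, 0 < ε → ε ≤ ε₀ → ∀ ε₁ : ℝ, 0 ≤ ε₁ → ε₁ < ε ^ 2 →
      ∀ {n₁ : ℕ} (V : CConf n₁), V ∈ smallFieldC ε₁ →
        (∃! U : Conf L n₁, U ∈ smallField ε ∧ IsConstrainedCritical V U) ∧
          ∀ U : Conf L n₁, U ∈ smallField ε → IsConstrainedCritical V U →
            ∃ ε' : ℝ, ε₁ ≤ ε' ^ 2 ∧ ε' < ε ∧ U ∈ smallField ε' := by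
  obtain ⟨ε₀, hε₀0, hε₀1, hall⟩ := theorem1_uniform (L := L) hL1
  refine ⟨ε₀, hε₀0, hε₀1, fun ε hε0 hεε₀ ε₁ hε₁0 hε₁ n₁ V hV =>
    ⟨hall ε hε0 hεε₀ ε₁ hε₁0 hε₁.le V hV, fun U hU hc => ?_⟩⟩
  -- `ε′ := max(√ε₁, ε/2)`: `ε₁ ≤ ε′²` and `ε′ < ε`
  have hs : Real.sqrt ε₁ < ε := (Real.sqrt_lt' hε0).mpr hε₁
  have hε'lt : max (Real.sqrt ε₁) (ε / 2) < ε := max_lt hs (by linarith)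
  have hε'pos : 0 < max (Real.sqrt ε₁) (ε / 2) := lt_max_of_lt_right (by linarith)
  have hε₁' : ε₁ ≤ max (Real.sqrt ε₁) (ε / 2) ^ 2 :=
    calc ε₁ = Real.sqrt ε₁ ^ 2 := (Real.sq_sqrt hε₁0).symm
      _ ≤ max (Real.sqrt ε₁) (ε / 2) ^ 2 := pow_le_pow_left₀ (Real.sqrt_nonneg _) (le_max_left _ _) 2
  exact ⟨max (Real.sqrt ε₁) (ε / 2), hε₁', hε'lt, mem_smallField_of_existsUnique hε'lt.le
    (hall ε hε0 hεε₀ ε₁ hε₁0 hε₁.le V hV)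
    ((hall _ hε'pos (hε'lt.le.trans hεε₀) ε₁ hε₁0 hε₁' V hV).exists) hU hc⟩

/-- **Remark 1.1 (3), strict small-field inequalities**: for `0 < ε ≤ ε₀(L)`, `0 ≤ ε₁ < ε²`, `V ∈ Conf_{ε₁}(Ω₁)`, every constrained
critical `U ∈ Conf_ε(Ω)` satisfies `‖∂U(b) − 1‖ < ε` for EVERY bond `b` — «not at the boundary of `Conf_ε(Ω)`», the boundary
cases `‖∂U(b) − 1‖ = ε` of the defining condition (small-field-condition) being excluded.
[cite: DybalskiStottmeisterTanimoto2024, §1.1 Remark 1.1 (3), (small-field-condition)] -/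
theorem remark11_strict (hL1 : 1 < L) :
    ∃ ε₀ : ℝ, 0 < ε₀ ∧ ε₀ ≤ 1 ∧ ∀ ε : ℝ, 0 < ε → ε ≤ ε₀ → ∀ ε₁ : ℝ, 0 ≤ ε₁ → ε₁ < ε ^ 2 →
      ∀ {n₁ : ℕ} (V : CConf n₁), V ∈ smallFieldC ε₁ →
        ∀ U : Conf L n₁, U ∈ smallField ε → IsConstrainedCritical V U → ∀ b : Bond L n₁, ‖(pd U b).val - 1‖ < ε := by
  obtain ⟨ε₀, hε₀0, hε₀1, hall⟩ := remark11 (L := L) hL1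
  refine ⟨ε₀, hε₀0, hε₀1, fun ε hε0 hεε₀ ε₁ hε₁0 hε₁ n₁ V hV U hU hc b => ?_⟩
  obtain ⟨ε', -, hε'lt, hU'⟩ := (hall ε hε0 hεε₀ ε₁ hε₁0 hε₁ V hV).2 U hU hc
  exact (hU' b).trans_lt hε'lt

/-! ### The topological reading: `U ∈ interior (Conf_ε(Ω))` in `Conf(Ω) = Ω → SU(2)` -/

/-- Chord ≤ arc on `SU(2)`: `‖p − q‖_ℍ ≤ d(p, q)` for the tree's great-circle distance `d(p,q) = ∠(p,q)` (`cos d(p,q) = ⟨p,q⟩`,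
`1 − θ²/2 ≤ cos θ`). [cite: DybalskiStottmeisterTanimoto2024, §1.1 Remark 1.1 (3) («the interior of `Conf_ε(Ω)`»)] -/
theorem SU2.norm_val_sub_val_le_dist (p q : SU2) : ‖p.val - q.val‖ ≤ dist p q := by
  have h1 : ‖p.val - q.val‖ ^ 2 = 2 - 2 * Real.cos (dist p q) := by
    rw [@norm_sub_sq_real, p.norm_val, q.norm_val, SU2.cos_dist]; ring
  have h2 : ‖p.val - q.val‖ ^ 2 ≤ dist p q ^ 2 := by
    rw [h1]; have := Real.one_sub_sq_div_two_le_cos (x := dist p q); linarith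
  exact le_of_pow_le_pow_left₀ two_ne_zero dist_nonneg h2

/-- The inclusion `SU(2) ↪ ℍ` is `1`-Lipschitz for the great-circle distance. [cite: DybalskiStottmeisterTanimoto2024, §1.1 Remark 1.1 (3)] -/
theorem SU2.lipschitzWith_val : LipschitzWith 1 (SU2.val : SU2 → ℍ) :=
  LipschitzWith.of_dist_le_mul fun p q => by
    rw [NNReal.coe_one, one_mul, dist_eq_norm]; exact SU2.norm_val_sub_val_le_dist p q

/-- The inclusion `SU(2) ↪ ℍ` is continuous. [cite: DybalskiStottmeisterTanimoto2024, §1.1 Remark 1.1 (3)] -/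
theorem SU2.continuous_val : Continuous (SU2.val : SU2 → ℍ) := SU2.lipschitzWith_val.continuous

/-- Each bond variable `U ↦ ∂U(b) = U(b₋)U(b₊)*` is continuous on `Conf(Ω) = Ω → SU(2)` (product topology).
[cite: DybalskiStottmeisterTanimoto2024, §1.1 (small-field-condition), Remark 1.1 (3)] -/
theorem continuous_pd_val (b : Bond L n₁) : Continuous fun U : Conf L n₁ => (pd U b).val := by
  have h : (fun U : Conf L n₁ => (pd U b).val) = fun U => (U b.src).val * star (U b.tgt).val := by
    funext U; exact pd_val U b
  rw [h]
  exact ((SU2.continuous_val.comp (continuous_apply b.src)).mul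
    ((SU2.continuous_val.comp (continuous_apply b.tgt)).star))

/-- The strict small-field set `{U | ∀ b, ‖∂U(b) − 1‖ < ε}` is open in `Conf(Ω)` (finitely many bonds).
[cite: DybalskiStottmeisterTanimoto2024, §1.1 (small-field-condition), Remark 1.1 (3)] -/
theorem isOpen_strictSmallField (ε : ℝ) : IsOpen {U : Conf L n₁ | ∀ b : Bond L n₁, ‖(pd U b).val - 1‖ < ε} := by
  have h : {U : Conf L n₁ | ∀ b : Bond L n₁, ‖(pd U b).val - 1‖ < ε} =
      ⋂ b : Bond L n₁, (fun U : Conf L n₁ => ‖(pd U b).val - 1‖) ⁻¹' Set.Iio ε := by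
    ext U; simp only [Set.mem_setOf_eq, Set.mem_iInter, Set.mem_preimage, Set.mem_Iio]
  rw [h]
  exact isOpen_iInter_of_finite fun b =>
    isOpen_Iio.preimage (((continuous_pd_val b).sub continuous_const).norm)

/-- The strict small-field set lies in the interior of `Conf_ε(Ω)`. [cite: DybalskiStottmeisterTanimoto2024, §1.1 Remark 1.1 (3)] -/
theorem strictSmallField_subset_interior (ε : ℝ) :
    {U : Conf L n₁ | ∀ b : Bond L n₁, ‖(pd U b).val - 1‖ < ε} ⊆ interior (smallField ε : Set (Conf L n₁)) :=
  interior_maximal (fun _U hU b => (hU b).le) (isOpen_strictSmallField ε)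

/-- **Remark 1.1 (3), topological form**: «Thus the unique critical point must belong to the interior of `Conf_ε(Ω)`» — for
`0 < ε ≤ ε₀(L)`, `0 ≤ ε₁ < ε²`, `V ∈ Conf_{ε₁}(Ω₁)`: the constrained critical point over `Conf_ε(Ω)` exists uniquely and every
constrained critical `U ∈ Conf_ε(Ω)` is an INTERIOR point of `Conf_ε(Ω) ⊆ Conf(Ω) = Ω → SU(2)` (product topology of the
great-circle metric on `SU(2)`). [cite: DybalskiStottmeisterTanimoto2024, §1.1 Remark 1.1 (3)] -/
theorem remark11_interior (hL1 : 1 < L) :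
    ∃ ε₀ : ℝ, 0 < ε₀ ∧ ε₀ ≤ 1 ∧ ∀ ε : ℝ, 0 < ε → ε ≤ ε₀ → ∀ ε₁ : ℝ, 0 ≤ ε₁ → ε₁ < ε ^ 2 →
      ∀ {n₁ : ℕ} (V : CConf n₁), V ∈ smallFieldC ε₁ →
        (∃! U : Conf L n₁, U ∈ smallField ε ∧ IsConstrainedCritical V U) ∧
          ∀ U : Conf L n₁, U ∈ smallField ε → IsConstrainedCritical V U →
            U ∈ interior (smallField ε : Set (Conf L n₁)) := by
  obtain ⟨ε₀, hε₀0, hε₀1, hall⟩ := remark11 (L := L) hL1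
  refine ⟨ε₀, hε₀0, hε₀1, fun ε hε0 hεε₀ ε₁ hε₁0 hε₁ n₁ V hV =>
    ⟨(hall ε hε0 hεε₀ ε₁ hε₁0 hε₁ V hV).1, fun U hU hc => ?_⟩⟩
  obtain ⟨ε', -, hε'lt, hU'⟩ := (hall ε hε0 hεε₀ ε₁ hε₁0 hε₁ V hV).2 U hU hc
  exact strictSmallField_subset_interior ε fun b => (hU' b).trans_lt hε'lt

end

end Literature.MathematicalPhysics.QuantumFieldTheory.DybalskiStottmeisterTanimoto2024.DST24InteriorCriticalPoint
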